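import Summits.HodgeConjecture.HodgeConjecture.Theorems.R90S3UnramifiedOfUnitRadicand   -- ★ p863812 (this seat): `isUnramifiedAt_of_sq_eq_of_sq_sub_mem_span_four` (+ ★ P6 (i) `QuadraticUnramifiedAtUnitPlace`)
import Literature.NumberTheory.Automorphic.UnitaryGroupNonsplitPlace                      -- ★ CM vocabulary (`UnitaryGroup.PlacesOver`, `maximalRealSubfield`)
import HarnessLib

/-!
# R90-TF · S3 · THEOREMS — `R90S3UnramifiedOffPlantedPlace` ((U3-F) split, brick P8c): the ⟪U⟫-field clause of the socket — `E = F(√α)` is UNRAMIFIED at every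
# place over every finite `u ≠ v′`, from the odd-place data «`α` a unit off `v′`» and the dyadic data «`x² − αξ² ∈ (4)`, `αξ²` a unit at the dyadic `u ≠ v′`»

R90-TF section S3 (successor dealer R90-C12-plan (g2), deal 2026-09-05T01:01:25Z «P8c → K2E3-p21», binder bytes of record; census R90 bus 01:01:59Z); crux H413
(`stmt-HodgeConjecture-24833`, lane `--supports … --as helper`), route `HCCMUnconditional`.  Thin COMBINATOR paying the `hur′` clause
`∀ w′ ≠ v′, ∀ W : PlacesOver L′ w′, Algebra.IsUnramifiedAt (𝓞 L′⁺) W.1.asIdeal` (G `Cruxes/H413/Lines/R90_S3_LocalTransportWaveG.lean` :651 ∕ :675) of the (U3-F) socket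
`stub_R90_S3_auxGlobaliseField` inside the assembly P8 (captain K2E3-p17).  THEOREMS ONLY (no `def`, no `instance`, no notation, no named fact, no `sorry`); ★ imports
only; never imports `Cruxes/…/Lines`.

THE MATHEMATICS [Neukirch1999 Ch. III §2 Thm. (2.6); Omeara1963 §63A, §65A].  `E ∕ F` a quadratic extension of number fields, `δ ∈ E ∖ F`, `δ² = α ∈ 𝓞 F`, `v′` a finite
place of `F`.  ODD PLACES `u ≠ v′` (`2 ∉ 𝔭_u`): `α ∉ 𝔭_u` ⇒ unramified at every `W ∣ u` — ★ `NumberFields.isUnramifiedAt_of_sq_eq_of_not_mem` (P6 (i), the different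
`∋ 2δ`).  DYADIC PLACES `u ≠ v′` (`2 ∈ 𝔭_u`): with `ξ ≠ 0`, `m₁ := α ξ²`, `x² − m₁ ∈ (4)` and `m₁ ∉ 𝔭_u`, the element `δ₁ := δ ξ` has `δ₁² = m₁`, `δ₁ ∉ F`, so ★
`isUnramifiedAt_of_sq_eq_of_sq_sub_mem_span_four` (P6 (ii), the different `∋ 2θ − x = δ₁`, `θ = (x + δ₁)∕2`) gives unramifiedness at every `W ∣ u`.  (Design
constraint (C5) of the planted road: when the planted prime is `2` no global `α·□ ≡ 1 (mod 4)` need exist off `v′` without the auxiliary `ξ ∈ 𝔭_{v′}^e`, `x` by CRT.)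
* **`isUnramifiedAt_of_planted`** (dealer's binder bytes), `isUnramifiedIn_of_planted`, the `κ`-corollary `isUnramifiedAt_of_planted_one_add_four_mul` (`ξ = 1`, `x = 1`,
  `α = 1 + 4κ`), and the CM spelling **`isUnramifiedAt_of_planted_cm`** (`F := L′⁺`, `E := L′`; conclusion = socket :675 token for token).

HONEST LABEL: HC_CM is proved only modulo the 7 printed citations (2 remaining named inputs: hLiu418 = stmt-HodgeConjecture-24832, h413 =
stmt-HodgeConjecture-24833) until rung 0 closes; combinator toward the GENUINE residual (U3-F); proves nothing printed; count-neutral.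

## References
* [Neukirch1999] J. Neukirch, *Algebraic Number Theory* (1999), Ch. III §2 Thm. (2.6).
* [Omeara1963] O. T. O'Meara, *Introduction to Quadratic Forms* (1963), §63A, §65A.
-/

set_option autoImplicit false
-- the mandated namespace repeats the single-problem summit's segment (`HodgeConjecture.HodgeConjecture`)
set_option linter.dupNamespace false

noncomputable section

namespace Summit.HodgeConjecture.HodgeConjecture.R90.S3

open NumberField IsDedekindDomain
open Literature.NumberTheory.NumberFields Literature.NumberTheory.Automorphic Literature.NumberTheory.Automorphic.UnitaryGroup

section General

variable {F : Type} (E : Type) [Field F] [NumberField F] [Field E] [NumberField E] [Algebra F E] [Algebra.IsQuadraticExtension F E]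

omit [NumberField F] [NumberField E] [Algebra.IsQuadraticExtension F E] in
/-- `δ ξ ∉ F` for `δ ∉ F` and `ξ ∈ F`, `ξ ≠ 0`. [cite: Neukirch1999, Ch. II §8] -/
theorem mul_algebraMap_not_mem_range {δ : E} (hδF : δ ∉ (algebraMap F E).range) {ξ : F} (hξ : ξ ≠ 0) :
    δ * algebraMap F E ξ ∉ (algebraMap F E).range := by
  rintro ⟨r, hr⟩
  refine hδF ⟨r * ξ⁻¹, ?_⟩
  rw [map_mul, map_inv₀, hr, mul_assoc, mul_inv_cancel₀ ((map_ne_zero _).2 hξ), mul_one]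

/-- **P8c — `E = F(√α)` IS UNRAMIFIED AT EVERY PLACE OVER EVERY FINITE `u ≠ v′`** (the socket's `hur′` clause), from the ODD data «`α ∉ 𝔭_u` for `2 ∉ 𝔭_u`, `u ≠ v′`»
(★ `NumberFields.isUnramifiedAt_of_sq_eq_of_not_mem`) and the DYADIC data «`m₁ = α ξ²`, `ξ ≠ 0`, `x² − m₁ ∈ (4)`, `m₁ ∉ 𝔭_u` for `2 ∈ 𝔭_u`, `u ≠ v′`» (★
`isUnramifiedAt_of_sq_eq_of_sq_sub_mem_span_four` at `δ₁ = δ ξ`).  Binder bytes of record (dealer 01:01:25Z). [cite: Neukirch1999, Ch. III §2 Thm. (2.6)] [cite: Omeara1963, §63A, §65A] -/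
theorem isUnramifiedAt_of_planted (v' : HeightOneSpectrum (𝓞 F)) {δ : E} (α : 𝓞 F) (hδ : δ ^ 2 = algebraMap F E (α : F))
    (hδF : δ ∉ (algebraMap F E).range)
    (hαu : ∀ u : HeightOneSpectrum (𝓞 F), u ≠ v' → (2 : 𝓞 F) ∉ u.asIdeal → α ∉ u.asIdeal)
    (x m₁ ξ : 𝓞 F) (hξ : ξ ≠ 0) (hm₁ : m₁ = α * ξ ^ 2) (hx : x ^ 2 - m₁ ∈ Ideal.span {(4 : 𝓞 F)})
    (hm₁u : ∀ u : HeightOneSpectrum (𝓞 F), u ≠ v' → (2 : 𝓞 F) ∈ u.asIdeal → m₁ ∉ u.asIdeal) :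
    ∀ u : HeightOneSpectrum (𝓞 F), u ≠ v' → ∀ W : PlacesOver E u, Algebra.IsUnramifiedAt (𝓞 F) W.1.asIdeal := by
  intro u hu W
  by_cases h2 : (2 : 𝓞 F) ∈ u.asIdeal
  · -- dyadic `u`: the `x`-version at `δ₁ = δ ξ`, `δ₁² = α ξ² = m₁`
    have hξF : (ξ : F) ≠ 0 := fun h0 => hξ (by exact_mod_cast h0)
    have hδ₁ : (δ * algebraMap F E (ξ : F)) ^ 2 = algebraMap F E (m₁ : F) := by
      rw [mul_pow, hδ, ← map_pow, ← map_mul, hm₁]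
      push_cast
      ring_nf
    exact isUnramifiedAt_of_sq_eq_of_sq_sub_mem_span_four E u W x m₁ hδ₁ (mul_algebraMap_not_mem_range E hδF hξF) hx (hm₁u u hu h2)
  · -- odd `u`: `α` is a `u`-unit
    exact isUnramifiedAt_of_sq_eq_of_not_mem E u W α hδ.symm hδF (hαu u hu h2) h2

/-- `Algebra.IsUnramifiedIn` form of `isUnramifiedAt_of_planted`: every finite `u ≠ v′` is unramified in `E`. [cite: Neukirch1999, Ch. III §2 Thm. (2.6)] -/
theorem isUnramifiedIn_of_planted (v' : HeightOneSpectrum (𝓞 F)) {δ : E} (α : 𝓞 F) (hδ : δ ^ 2 = algebraMap F E (α : F))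
    (hδF : δ ∉ (algebraMap F E).range)
    (hαu : ∀ u : HeightOneSpectrum (𝓞 F), u ≠ v' → (2 : 𝓞 F) ∉ u.asIdeal → α ∉ u.asIdeal)
    (x m₁ ξ : 𝓞 F) (hξ : ξ ≠ 0) (hm₁ : m₁ = α * ξ ^ 2) (hx : x ^ 2 - m₁ ∈ Ideal.span {(4 : 𝓞 F)})
    (hm₁u : ∀ u : HeightOneSpectrum (𝓞 F), u ≠ v' → (2 : 𝓞 F) ∈ u.asIdeal → m₁ ∉ u.asIdeal) :
    ∀ u : HeightOneSpectrum (𝓞 F), u ≠ v' → Algebra.IsUnramifiedIn (𝓞 E) u.asIdeal := by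
  intro u hu P hP hlo
  have hPbot : P ≠ ⊥ := Ideal.ne_bot_of_liesOver_of_ne_bot u.ne_bot P
  exact isUnramifiedAt_of_planted E v' α hδ hδF hαu x m₁ ξ hξ hm₁ hx hm₁u u hu ⟨⟨P, hP, hPbot⟩, HeightOneSpectrum.ext hlo.over.symm⟩

/-- **The `κ`-corollary** (`ξ = 1`, `x = 1`, `α = 1 + 4κ`): if `δ² = 1 + 4κ`, `κ ∈ 𝓞 F`, and `1 + 4κ ∉ 𝔭_u` at every ODD `u ≠ v′`, then `E` is unramified at every place over every
finite `u ≠ v′` (the dyadic places are automatic). [cite: Neukirch1999, Ch. III §2 Thm. (2.6)] [cite: Omeara1963, §63A] -/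
theorem isUnramifiedAt_of_planted_one_add_four_mul (v' : HeightOneSpectrum (𝓞 F)) {δ : E} (κ : 𝓞 F) (hδ : δ ^ 2 = 1 + 4 * algebraMap F E (κ : F))
    (hδF : δ ∉ (algebraMap F E).range)
    (hαu : ∀ u : HeightOneSpectrum (𝓞 F), u ≠ v' → (2 : 𝓞 F) ∉ u.asIdeal → (1 + 4 * κ : 𝓞 F) ∉ u.asIdeal) :
    ∀ u : HeightOneSpectrum (𝓞 F), u ≠ v' → ∀ W : PlacesOver E u, Algebra.IsUnramifiedAt (𝓞 F) W.1.asIdeal := by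
  intro u hu W
  by_cases h2 : (2 : 𝓞 F) ∈ u.asIdeal
  · exact isUnramifiedAt_of_sq_eq_one_add_four_mul_of_two_mem E u W κ hδ hδF h2
  · exact isUnramifiedAt_of_sq_eq_one_add_four_mul E u W κ hδ hδF (hαu u hu h2)

end General

/-! ## The CM spelling (`F := L′⁺`, `E := L′`): the socket's `hur′` clause token for token -/

/-- **P8c, CM SPELLING**: for a CM field `L′` with `L′ = L′⁺(δ)`, `δ² = α`, the odd data «`α` a unit off `v′`» and the dyadic data «`x² − αξ² ∈ (4)`, `αξ²` a unit at the dyadic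
`u ≠ v′`», the socket's clause `∀ w′ ≠ v′, ∀ W : PlacesOver L′ w′, Algebra.IsUnramifiedAt (𝓞 L′⁺) W.1.asIdeal` holds (G :651 ∕ :675 bytes; the instance
`Algebra.IsQuadraticExtension L′⁺ L′` is Mathlib's `IsCMField.isQuadraticExtension`). [cite: Neukirch1999, Ch. III §2 Thm. (2.6)] [cite: Omeara1963, §63A, §65A] -/
theorem isUnramifiedAt_of_planted_cm (L' : Type) [Field L'] [NumberField L'] [IsCMField L']
    (v' : HeightOneSpectrum (𝓞 ↥(maximalRealSubfield L'))) {δ : L'} (α : 𝓞 ↥(maximalRealSubfield L'))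
    (hδ : δ ^ 2 = algebraMap ↥(maximalRealSubfield L') L' (α : ↥(maximalRealSubfield L')))
    (hδF : δ ∉ (algebraMap ↥(maximalRealSubfield L') L').range)
    (hαu : ∀ u : HeightOneSpectrum (𝓞 ↥(maximalRealSubfield L')), u ≠ v' → (2 : 𝓞 ↥(maximalRealSubfield L')) ∉ u.asIdeal → α ∉ u.asIdeal)
    (x m₁ ξ : 𝓞 ↥(maximalRealSubfield L')) (hξ : ξ ≠ 0) (hm₁ : m₁ = α * ξ ^ 2) (hx : x ^ 2 - m₁ ∈ Ideal.span {(4 : 𝓞 ↥(maximalRealSubfield L'))})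
    (hm₁u : ∀ u : HeightOneSpectrum (𝓞 ↥(maximalRealSubfield L')), u ≠ v' → (2 : 𝓞 ↥(maximalRealSubfield L')) ∈ u.asIdeal → m₁ ∉ u.asIdeal) :
    ∀ w' : HeightOneSpectrum (𝓞 ↥(maximalRealSubfield L')), w' ≠ v' → ∀ W : UnitaryGroup.PlacesOver L' w',
      Algebra.IsUnramifiedAt (𝓞 ↥(maximalRealSubfield L')) W.1.asIdeal :=
  isUnramifiedAt_of_planted L' v' α hδ hδF hαu x m₁ ξ hξ hm₁ hx hm₁u

end Summit.HodgeConjecture.HodgeConjecture.R90.S3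

end
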